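import Literature.AlgebraicTopology.SingularHomology.LocalHomology
import HarnessLib

/-!
# Vanishing of singular homology is invariant under homeomorphisms across universes

For a homeomorphism `e : X ≃ₜ Y` between spaces `X : Type u` and `Y : Type w` in *different*
universes, the singular homology groups `Hₙ(X; M) : ModuleCat.{max u v} R` and
`Hₙ(Y; M) : ModuleCat.{max w v} R` (concrete model `Literature.AlgebraicTopology.SingularHomology.csingularHomology` of
`…SingularChainsConcrete`, or Mathlib's `Literature.AlgebraicTopology.SingularHomology.singularHomology`) live in different categories, so
neither `csingularHomology.mapIso` nor any isomorphism relates them, and the induced chain map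
`csingularChainComplex.map`/`SingularSimplex.map` (Mathlib's `TopCat.toSSet.map`) is only defined
within one universe. This file supplies the universe-polymorphic substitute needed to move
homological statements along such homeomorphisms (client: the `Shrink.{0} X ≃ₜ X` transport of
`Literature.Topology.FourManifolds.GluckTwistHomologyProofs`, `H₂` of a Gluck twist at every
universe):

* `SingularSimplex.push f σ = f ∘ σ` for `f : C(X, Y)` across universes (via
  `SingularSimplex.toContinuousMap`), with `push_face`, `push_push`, `push_id`, `push_push_symm`;
* `CChain.push R M f n : Cₙ(X; M) →ₗ[R] Cₙ(Y; M)` (`Finsupp.lmapDomain`), a chain map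
  (`CChain.bd_push`: `∂ ∘ f♯ = f♯ ∘ ∂`, Hatcher 2002, §2.1), inverse to `CChain.push … e.symm` for a
  homeomorphism (`CChain.push_push_symm`);
* **`csingularHomology.isZero_of_homeomorph`**: `Hₙ(X; M) = 0 ⟹ Hₙ(Y; M) = 0` for `e : X ≃ₜ Y`
  across universes, proved elementwise (every cycle is a boundary, `Literature.AlgebraicTopology.SingularHomology.isZero_homology_iff` of
  `…ChainSubcomplex`).

Everything is proved ([folklore] over Hatcher §2.1); nothing is asserted.

## References

* A. Hatcher, *Algebraic Topology*, CUP 2002, §2.1 (chain maps induced by continuous maps,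
  Prop. 2.9 ff.) [HatcherAT2002].

## Design notes

* As in `…SingularChainsConcrete`/`…LocalHomology`, `backward.isDefEq.respectTransparency` is
  turned off (chains of the concrete complex are `Finsupp`s up to unfolding).
* Only the vanishing statement is transported; a universe-changing comparison *isomorphism* would
  need `ULift`ed module categories and is not attempted.
* No declaration in this file uses `sorry`.
-/

noncomputable section

open CategoryTheory Limits Set

universe u v w

namespace Literature.AlgebraicTopology.SingularHomology

variable (R : Type v) [CommRing R] (M : Type v) [AddCommGroup M] [Module R M]

/-! ### Homology vanishing is transported along homeomorphisms across universes -/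

section UniverseTransport

-- as in `SingularChainsConcrete` / `LocalHomology`: chains of the concrete complex are `Finsupp`s
-- up to unfolding
set_option backward.isDefEq.respectTransparency false

variable {X : Type u} {Y : Type w} [TopologicalSpace X] [TopologicalSpace Y] {n : ℕ}

namespace SingularSimplex

/-- Push-forward `f ∘ ρ` of a singular simplex along a continuous map between spaces in possibly
different universes (`SingularSimplex.map` needs one universe, being `TopCat.toSSet.map`).
[folklore] -/
def push (f : C(X, Y)) (ρ : SingularSimplex X n) : SingularSimplex Y n :=
  toContinuousMap.symm (f.comp (toContinuousMap ρ))

omit R M in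
/-- The continuous map of `ρ.push f` is `f ∘ ρ`. [folklore] -/
@[simp]
theorem toContinuousMap_push (f : C(X, Y)) (ρ : SingularSimplex X n) :
    toContinuousMap (ρ.push f) = f.comp (toContinuousMap ρ) :=
  Equiv.apply_symm_apply _ _

omit R M in
/-- Push-forward commutes with faces. [folklore] -/
theorem push_face (f : C(X, Y)) (i : Fin (n + 2)) (ρ : SingularSimplex X (n + 1)) :
    (ρ.face i).push f = (ρ.push f).face i := by
  apply toContinuousMap_injective
  rw [toContinuousMap_push, toContinuousMap_face, toContinuousMap_face, toContinuousMap_push,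
    ContinuousMap.comp_assoc]

omit R M in
/-- Push-forward is functorial. [folklore] -/
theorem push_push {Z : Type*} [TopologicalSpace Z] (f : C(X, Y)) (g : C(Y, Z))
    (ρ : SingularSimplex X n) : (ρ.push f).push g = ρ.push (g.comp f) := by
  apply toContinuousMap_injective
  rw [toContinuousMap_push, toContinuousMap_push, toContinuousMap_push, ContinuousMap.comp_assoc]

omit R M in
/-- Push-forward along the identity. [folklore] -/
@[simp]
theorem push_id (ρ : SingularSimplex X n) : ρ.push (ContinuousMap.id X) = ρ := by
  apply toContinuousMap_injective
  rw [toContinuousMap_push, ContinuousMap.id_comp]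

omit R M in
/-- Push-forward along a homeomorphism and back. [folklore] -/
@[simp]
theorem push_push_symm (e : X ≃ₜ Y) (ρ : SingularSimplex X n) :
    (ρ.push (e : C(X, Y))).push (e.symm : C(Y, X)) = ρ := by
  rw [push_push]
  convert push_id ρ
  ext x
  exact e.symm_apply_apply x

end SingularSimplex

/-- Push-forward of concrete chains along a continuous map across universes
(`Finsupp.mapDomain` of `SingularSimplex.push`). [folklore] -/
def CChain.push (f : C(X, Y)) (n : ℕ) : CChain M X n →ₗ[R] CChain M Y n :=
  Finsupp.lmapDomain M R (SingularSimplex.push f)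

/-- `CChain.push` on an elementary chain. [folklore] -/
@[simp]
theorem CChain.push_single (f : C(X, Y)) (ρ : SingularSimplex X n) (m : M) :
    CChain.push R M f n (Finsupp.single ρ m) = Finsupp.single (ρ.push f) m :=
  Finsupp.mapDomain_single

/-- Push-forward is a chain map: `∂ ∘ f♯ = f♯ ∘ ∂` (Hatcher 2002, §2.1). [folklore] -/
theorem CChain.bd_push (f : C(X, Y)) (c : CChain M X (n + 1)) :
    csingularChainComplex.bd R n (CChain.push R M f (n + 1) c) =
      CChain.push R M f n (csingularChainComplex.bd R n c) := by
  refine Finsupp.induction_linear c (by simp) (fun g g' hg hg' => ?_) fun ρ m => ?_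
  · rw [map_add, map_add, hg, hg', map_add, map_add]
  · rw [CChain.push_single, csingularChainComplex.bd_single, csingularChainComplex.bd_single,
      map_sum]
    refine Finset.sum_congr rfl fun i _ => ?_
    rw [map_smul, CChain.push_single, SingularSimplex.push_face]

/-- Push-forward along a homeomorphism and back is the identity on chains. [folklore] -/
theorem CChain.push_push_symm (e : X ≃ₜ Y) (c : CChain M X n) :
    CChain.push R M (e.symm : C(Y, X)) n (CChain.push R M (e : C(X, Y)) n c) = c := by
  refine Finsupp.induction_linear c (by simp) (fun g g' hg hg' => ?_) fun ρ m => ?_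
  · rw [map_add, map_add, hg, hg']
  · rw [CChain.push_single, CChain.push_single, SingularSimplex.push_push_symm]

/-- **Vanishing of concrete singular homology is invariant under homeomorphisms across
universes**: for `e : X ≃ₜ Y` with `X : Type u`, `Y : Type w`, `Hₙ(X; M) = 0 ⟹ Hₙ(Y; M) = 0`
(the two groups live in different categories `ModuleCat.{max u v}`, `ModuleCat.{max w v}`, so no
isomorphism is available; the statement is proved elementwise: cycles and boundaries are
transported by the chain isomorphism `e♯`). [folklore] -/
theorem csingularHomology.isZero_of_homeomorph (e : X ≃ₜ Y)
    (h : IsZero (csingularHomology R M X n)) : IsZero (csingularHomology R M Y n) := by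
  rw [csingularHomology, isZero_homology_iff] at h ⊢
  intro z hz
  rw [exists_d_prev_eq_iff (ChainComplex.prev ℕ n)]
  -- pull the cycle back to `X`
  set z' : CChain M X n := CChain.push R M (e.symm : C(Y, X)) n z with hz'
  have hcyc : (csingularChainComplex R M X).d n ((ComplexShape.down ℕ).next n) z' = 0 := by
    cases n with
    | zero =>
      rw [d_next_eq_zero_iff ChainComplex.next_nat_zero,
        (csingularChainComplex R M X).shape 0 0 (by simp)]
      rfl
    | succ m =>
      rw [d_next_eq_zero_iff (ChainComplex.next_nat_succ m)] at hz ⊢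
      rw [csingularChainComplex.d_apply] at hz ⊢
      rw [hz', CChain.bd_push, hz, map_zero]
  obtain ⟨w', hw'⟩ :=
    (exists_d_prev_eq_iff (K := csingularChainComplex R M X) (ChainComplex.prev ℕ n) z').1
      (h z' hcyc)
  refine ⟨CChain.push R M (e : C(X, Y)) (n + 1) w', ?_⟩
  rw [csingularChainComplex.d_apply] at hw' ⊢
  rw [CChain.bd_push, hw', hz']
  simpa using CChain.push_push_symm R M e.symm z

end UniverseTransport

end Literature.AlgebraicTopology.SingularHomology

end
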